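import Summits.ResolutionOfSingularities.ResolutionOfSingularities.Theorems.EquisingularLiftEquisingularLiftNatDeltaPointResolutionStrong
import HarnessLib

/-!
# [OURS · L1 W4.5(b) · EL♮] T-INST «TANGENT-CONE-Δ POINT RESOLUTIONS LIFT» — res-L1-w45b-lead-2's skeleton-v5 stub
# `stub_elnat_tcDeltaPointResolution` (TARGET-T-ISO-0PLUS.lean f6dcd08c24429701 = skeleton v5.1 / child v2.1) AS AN INSTANCE OF T-ISO-0⁺, modulo the carrier lift

Crux `EquisingularLiftNat` = stmt-ResolutionOfSingularities-20038 (child EL♮(3) = stmt-20148), route EquisingularLift, line `sections`;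
helper file `--supports … --as helper` by res-D-pv-029 (T-INST named by res-L1-w45b-lead-2 2026-08-27T08:06:58Z). HONEST FRAMING: OURS
(cell res-hironaka, slot W4.5(b)); NOT a statement of any manuscript. AI-written, weaker than expert review. No `sorry`; standard axioms.

WHAT. `stub_elnat_tcDeltaPointResolution_of_carrierLift` = the registered stub VERBATIM with ONE hypothesis inserted after the
locally-principal clause: the LIFT HYPOTHESIS HΔ(AdmTC) — T-ISO-0⁺'s `HΔ(Adm)` (…NatDeltaPointResolutionStrong,
`target_elnat_of_deltaPointResolution'`) at the tangent-cone admissibility predicate of the stub,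
`AdmTC F₁ F₂ υ x Z :⟺ ∃ W hZ, x ∈ W ∧ ¬ (υ⁻¹{x} ⊆ closure υ⁻¹(W ∖ {x})) ∧ (closure W principal on an affine open ∋ x) ∧
Sing(V(Z)_red) finite ∧ Z = vanishingIdeal (υ⁻¹{x} ∩ closure υ⁻¹(W ∖ {x}))`, written out (no definition). So the stub itself follows
from this file and ONE supplier theorem HΔ(AdmTC) — res-type-100's T-CARRIER-Δ (i)(ii)(iv)+(v) fed by T-TCONE (lead-2's NAMING
08:06:58Z) — by `fun … => stub_elnat_tcDeltaPointResolution_of_carrierLift … HΔTC …`.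

PROOF. `target_elnat_of_deltaPointResolution'` at `Adm := AdmTC`; the stub's downstairs closure (constructors (P), (TC)) is contained
in T-ISO-0⁺'s (constructors (pt), (pt;Δ[AdmTC])): (P) = (pt) verbatim (good-point clause included), and (TC) is (pt;Δ) at
`Z := vanishingIdeal (υ⁻¹{x} ∩ closure υ⁻¹(W ∖ {x}))` (support = the set; E1 = the stub's `⊆ T₂` clause; the stub's extra clause
«`T₂ ⊄ Z`» of v5.1 is not needed by the strong form and is dropped).

References: …NatDeltaPointResolutionStrong.lean (res-D-pv-029), …NatDeltaPointResolution.lean (p512946), res-L1-w45b-lead-2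
TARGET-T-ISO-0PLUS.lean f6dcd08c24429701 / SkeletonELnat-v5.1 (OURS planning texts, index only).
-/

set_option linter.dupNamespace false -- mandated namespace `Summit.<Summit>.<Problem>` of this single-conjunct summit

noncomputable section

open CategoryTheory CategoryTheory.Limits AlgebraicGeometry TopologicalSpace Topology
open Literature.AlgebraicGeometry.Resolution
open AlgebraicGeometry.Scheme.IdealSheafData

namespace Summit.ResolutionOfSingularities.ResolutionOfSingularities.Cruxes.EquisingularLiftNat.Sections

/-- **T-INST: the skeleton-v5 stub `stub_elnat_tcDeltaPointResolution` modulo the carrier lift HΔ(AdmTC)** (see the module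
docstring). [folklore; instance of `target_elnat_of_deltaPointResolution'`] -/
theorem stub_elnat_tcDeltaPointResolution_of_carrierLift (p : ℕ) : p.Prime → ∀ (k : Type) [Field k] [CharP k p] [IsAlgClosed k] (n : ℕ) (H : AlgebraicGeometry.Scheme.{0}) (ι : H ⟶ (Literature.AlgebraicGeometry.Motives.projectiveSpace n k).left), AlgebraicGeometry.IsClosedImmersion ι → AlgebraicGeometry.IsIntegral H → (∀ y : (Literature.AlgebraicGeometry.Motives.projectiveSpace n k).left, ∃ U : (Literature.AlgebraicGeometry.Motives.projectiveSpace n k).left.affineOpens, y ∈ (U : (Literature.AlgebraicGeometry.Motives.projectiveSpace n k).left.Opens) ∧ (ι.ker.ideal U).IsPrincipal) →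
    -- THE LIFT HYPOTHESIS HΔ(AdmTC) (= res-type-100's T-CARRIER-Δ in consumer form, fed by T-TCONE): in every section-blow-up
    -- situation over a complete DVR `O ↠ k`, with the model squares of T-ISO-0⁺, the reduced tangent-cone trace `υ⁻¹{x} ∩ St(W)`
    -- of a hypersurface germ `W ∋ x` (not all of the exceptional locus, finitely many singular points) lifts to an in-carrier centre
    (∀ (O : Type) [CommRing O] [IsDomain O] [IsDiscreteValuationRing O] [IsAdicComplete (IsLocalRing.maximalIdeal O) O]
        [IsAlgClosed (IsLocalRing.ResidueField O)] (θ : O →+* k), Function.Surjective θ →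
      ∀ (X' : AlgebraicGeometry.Scheme.{0}) (r' : X' ⟶ AlgebraicGeometry.Spec (.of O)) [AlgebraicGeometry.IsIntegral X']
        [IsLocallyNoetherian X'], Literature.AlgebraicGeometry.Resolution.Scheme.IsRegular X' → AlgebraicGeometry.IsProper r' →
      ∀ (U : X'.Opens), AlgebraicGeometry.Smooth (U.ι ≫ r') →
      ∀ (s : AlgebraicGeometry.Spec (.of O) ⟶ X'), s ≫ r' = 𝟙 _ → s (IsLocalRing.closedPoint O) ∈ U →
      ∀ (X₁ : AlgebraicGeometry.Scheme.{0}) (τ₁ : X₁ ⟶ X'), Literature.AlgebraicGeometry.Resolution.IsBlowup τ₁ s.ker →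
      ∀ (F₁ : AlgebraicGeometry.Scheme.{0}) [AlgebraicGeometry.IsIntegral F₁] (j : F₁ ⟶ X')
        (t : F₁ ⟶ AlgebraicGeometry.Spec (.of k)),
        IsPullback j t r' (AlgebraicGeometry.Spec.map (CommRingCat.ofHom θ)) →
      ∀ (x : F₁) (hx : IsClosed ({x} : Set F₁)), s (IsLocalRing.closedPoint O) = j x →
      ∀ (F₂ : AlgebraicGeometry.Scheme.{0}) [AlgebraicGeometry.IsIntegral F₂] (υ : F₂ ⟶ F₁),
        Literature.AlgebraicGeometry.Resolution.IsBlowup υ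
          (AlgebraicGeometry.Scheme.IdealSheafData.vanishingIdeal (⟨{x}, hx⟩ : TopologicalSpace.Closeds F₁)) →
      ∀ (j₂ : F₂ ⟶ X₁) (t₂ : F₂ ⟶ AlgebraicGeometry.Spec (.of k)),
        IsPullback j₂ t₂ (τ₁ ≫ r') (AlgebraicGeometry.Spec.map (CommRingCat.ofHom θ)) → j₂ ≫ τ₁ = υ ≫ j →
        (s.ker.comap τ₁).comap j₂ =
          (AlgebraicGeometry.Scheme.IdealSheafData.vanishingIdeal (⟨{x}, hx⟩ : TopologicalSpace.Closeds F₁)).comap υ →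
      ∀ (W : Set F₁) (hZ : IsClosed (υ ⁻¹' {x} ∩ closure (υ ⁻¹' (W \ {x})))), x ∈ W →
        ¬ (υ ⁻¹' {x} ⊆ closure (υ ⁻¹' (W \ {x}))) →
        (∃ U₁ : F₁.affineOpens, x ∈ (U₁ : F₁.Opens) ∧
          ((AlgebraicGeometry.Scheme.IdealSheafData.vanishingIdeal
            (⟨closure W, isClosed_closure⟩ : TopologicalSpace.Closeds F₁)).ideal U₁).IsPrincipal) →
        Set.Finite {z : ↥(AlgebraicGeometry.Scheme.IdealSheafData.vanishingIdeal
            (⟨υ ⁻¹' {x} ∩ closure (υ ⁻¹' (W \ {x})), hZ⟩ : TopologicalSpace.Closeds F₂)).subscheme |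
          ¬ IsRegularLocalRing ((AlgebraicGeometry.Scheme.IdealSheafData.vanishingIdeal
            (⟨υ ⁻¹' {x} ∩ closure (υ ⁻¹' (W \ {x})), hZ⟩ : TopologicalSpace.Closeds F₂)).subscheme.presheaf.stalk z)} →
        ∃ C : X₁.IdealSheafData, Literature.AlgebraicGeometry.Resolution.Scheme.IsRegular C.subscheme ∧
          AlgebraicGeometry.Flat (C.subschemeι ≫ τ₁ ≫ r') ∧
          (C.support : Set X₁) ⊆ ((s.ker.comap τ₁).support : Set X₁) ∧
          C.comap j₂ = AlgebraicGeometry.Scheme.IdealSheafData.vanishingIdeal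
            (⟨υ ⁻¹' {x} ∩ closure (υ ⁻¹' (W \ {x})), hZ⟩ : TopologicalSpace.Closeds F₂)) → (∃ (F' : AlgebraicGeometry.Scheme.{0}) (ρ' : F' ⟶ (Literature.AlgebraicGeometry.Motives.projectiveSpace n k).left) (T' : Set F'), (∀ Q : (∀ F₁ : AlgebraicGeometry.Scheme.{0}, (F₁ ⟶ (Literature.AlgebraicGeometry.Motives.projectiveSpace n k).left) → Set F₁ → Prop), Q (Literature.AlgebraicGeometry.Motives.projectiveSpace n k).left (CategoryTheory.CategoryStruct.id (Literature.AlgebraicGeometry.Motives.projectiveSpace n k).left) (Set.range ι) → (∀ (F₁ F₂ : AlgebraicGeometry.Scheme.{0}) (ρ : F₁ ⟶ (Literature.AlgebraicGeometry.Motives.projectiveSpace n k).left) (T₁ : Set F₁) (x : ↥(AlgebraicGeometry.Scheme.IdealSheafData.vanishingIdeal (⟨closure T₁, isClosed_closure⟩ : TopologicalSpace.Closeds F₁)).subscheme) (υ : F₂ ⟶ F₁) (hx : IsClosed ({((AlgebraicGeometry.Scheme.IdealSheafData.vanishingIdeal (⟨closure T₁, isClosed_closure⟩ : TopologicalSpace.Closeds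 F₁)).subschemeι x : F₁)} : Set F₁)), Q F₁ ρ T₁ → ¬ IsRegularLocalRing ((AlgebraicGeometry.Scheme.IdealSheafData.vanishingIdeal (⟨closure T₁, isClosed_closure⟩ : TopologicalSpace.Closeds F₁)).subscheme.presheaf.stalk x) → IsRegularLocalRing (F₁.presheaf.stalk (((AlgebraicGeometry.Scheme.IdealSheafData.vanishingIdeal (⟨closure T₁, isClosed_closure⟩ : TopologicalSpace.Closeds F₁))).subschemeι x : F₁)) → Literature.AlgebraicGeometry.Resolution.IsBlowup υ (AlgebraicGeometry.Scheme.IdealSheafData.vanishingIdeal (⟨{((AlgebraicGeometry.Scheme.IdealSheafData.vanishingIdeal (⟨closure T₁, isClosed_closure⟩ : TopologicalSpace.Closeds F₁)).subschemeι x : F₁)}, hx⟩ : TopologicalSpace.Closeds F₁)) → Q F₂ (CategoryTheory.CategoryStruct.comp υ ρ) (closure (υ ⁻¹' (T₁ \ {((AlgebraicGeometry.Scheme.IdealSheafData.vanishingIdeal (⟨closure T₁, isClosed_closure⟩ : TopologicalSpace.Closeds F₁)).subschemeι x : F₁)})))) → (∀ (F₁ F₂ F₃ : AlgebraicGeometry.Scheme.{0})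 (ρ : F₁ ⟶ (Literature.AlgebraicGeometry.Motives.projectiveSpace n k).left) (T₁ : Set F₁) (x : ↥((AlgebraicGeometry.Scheme.IdealSheafData.vanishingIdeal (⟨closure T₁, isClosed_closure⟩ : TopologicalSpace.Closeds F₁))).subscheme) (υ : F₂ ⟶ F₁) (hx : IsClosed ({(((AlgebraicGeometry.Scheme.IdealSheafData.vanishingIdeal (⟨closure T₁, isClosed_closure⟩ : TopologicalSpace.Closeds F₁))).subschemeι x : F₁)} : Set F₁)) (W : Set F₁) (υ' : F₃ ⟶ F₂) (hZ : IsClosed (υ ⁻¹' {(((AlgebraicGeometry.Scheme.IdealSheafData.vanishingIdeal (⟨closure T₁, isClosed_closure⟩ : TopologicalSpace.Closeds F₁))).subschemeι x : F₁)} ∩ closure (υ ⁻¹' (W \ {(((AlgebraicGeometry.Scheme.IdealSheafData.vanishingIdeal (⟨closure T₁, isClosed_closure⟩ : TopologicalSpace.Closeds F₁))).subschemeι x : F₁)})))), Q F₁ ρ T₁ → ¬ IsRegularLocalRing (((AlgebraicGeometry.Scheme.IdealSheafData.vanishingIdeal (⟨closure T₁, isClosed_closure⟩ : TopologicalSpace.Closeds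 F₁))).subscheme.presheaf.stalk x) → IsRegularLocalRing (F₁.presheaf.stalk (((AlgebraicGeometry.Scheme.IdealSheafData.vanishingIdeal (⟨closure T₁, isClosed_closure⟩ : TopologicalSpace.Closeds F₁))).subschemeι x : F₁)) → Literature.AlgebraicGeometry.Resolution.IsBlowup υ (AlgebraicGeometry.Scheme.IdealSheafData.vanishingIdeal (⟨{(((AlgebraicGeometry.Scheme.IdealSheafData.vanishingIdeal (⟨closure T₁, isClosed_closure⟩ : TopologicalSpace.Closeds F₁))).subschemeι x : F₁)}, hx⟩ : TopologicalSpace.Closeds F₁)) → (((AlgebraicGeometry.Scheme.IdealSheafData.vanishingIdeal (⟨closure T₁, isClosed_closure⟩ : TopologicalSpace.Closeds F₁))).subschemeι x : F₁) ∈ W → ¬ (υ ⁻¹' {(((AlgebraicGeometry.Scheme.IdealSheafData.vanishingIdeal (⟨closure T₁, isClosed_closure⟩ : TopologicalSpace.Closeds F₁))).subschemeι x : F₁)} ⊆ closure (υ ⁻¹' (W \ {(((AlgebraicGeometry.Scheme.IdealSheafData.vanishingIdeal (⟨closure T₁, isClosed_closure⟩ : TopologicalSpace.Closeds F₁))).subschemeι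 x : F₁)}))) → (∃ U : F₁.affineOpens, (((AlgebraicGeometry.Scheme.IdealSheafData.vanishingIdeal (⟨closure T₁, isClosed_closure⟩ : TopologicalSpace.Closeds F₁))).subschemeι x : F₁) ∈ (U : F₁.Opens) ∧ ((AlgebraicGeometry.Scheme.IdealSheafData.vanishingIdeal (⟨closure W, isClosed_closure⟩ : TopologicalSpace.Closeds F₁)).ideal U).IsPrincipal) → (υ ⁻¹' {(((AlgebraicGeometry.Scheme.IdealSheafData.vanishingIdeal (⟨closure T₁, isClosed_closure⟩ : TopologicalSpace.Closeds F₁))).subschemeι x : F₁)} ∩ closure (υ ⁻¹' (W \ {(((AlgebraicGeometry.Scheme.IdealSheafData.vanishingIdeal (⟨closure T₁, isClosed_closure⟩ : TopologicalSpace.Closeds F₁))).subschemeι x : F₁)}))) ⊆ closure (υ ⁻¹' (T₁ \ {(((AlgebraicGeometry.Scheme.IdealSheafData.vanishingIdeal (⟨closure T₁, isClosed_closure⟩ : TopologicalSpace.Closeds F₁))).subschemeι x : F₁)})) → ¬ (closure (υ ⁻¹' (T₁ \ {(((AlgebraicGeometry.Scheme.IdealSheafData.vanishingIdeal (⟨closure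 T₁, isClosed_closure⟩ : TopologicalSpace.Closeds F₁))).subschemeι x : F₁)})) ⊆ (υ ⁻¹' {(((AlgebraicGeometry.Scheme.IdealSheafData.vanishingIdeal (⟨closure T₁, isClosed_closure⟩ : TopologicalSpace.Closeds F₁))).subschemeι x : F₁)} ∩ closure (υ ⁻¹' (W \ {(((AlgebraicGeometry.Scheme.IdealSheafData.vanishingIdeal (⟨closure T₁, isClosed_closure⟩ : TopologicalSpace.Closeds F₁))).subschemeι x : F₁)})))) → Set.Finite {z : ↥((AlgebraicGeometry.Scheme.IdealSheafData.vanishingIdeal (⟨(υ ⁻¹' {(((AlgebraicGeometry.Scheme.IdealSheafData.vanishingIdeal (⟨closure T₁, isClosed_closure⟩ : TopologicalSpace.Closeds F₁))).subschemeι x : F₁)} ∩ closure (υ ⁻¹' (W \ {(((AlgebraicGeometry.Scheme.IdealSheafData.vanishingIdeal (⟨closure T₁, isClosed_closure⟩ : TopologicalSpace.Closeds F₁))).subschemeι x : F₁)}))), hZ⟩ : TopologicalSpace.Closeds F₂))).subscheme | ¬ IsRegularLocalRing (((AlgebraicGeometry.Scheme.IdealSheafData.vanishingIdeal (⟨(υ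 ⁻¹' {(((AlgebraicGeometry.Scheme.IdealSheafData.vanishingIdeal (⟨closure T₁, isClosed_closure⟩ : TopologicalSpace.Closeds F₁))).subschemeι x : F₁)} ∩ closure (υ ⁻¹' (W \ {(((AlgebraicGeometry.Scheme.IdealSheafData.vanishingIdeal (⟨closure T₁, isClosed_closure⟩ : TopologicalSpace.Closeds F₁))).subschemeι x : F₁)}))), hZ⟩ : TopologicalSpace.Closeds F₂))).subscheme.presheaf.stalk z)} → Literature.AlgebraicGeometry.Resolution.IsBlowup υ' (AlgebraicGeometry.Scheme.IdealSheafData.vanishingIdeal (⟨(υ ⁻¹' {(((AlgebraicGeometry.Scheme.IdealSheafData.vanishingIdeal (⟨closure T₁, isClosed_closure⟩ : TopologicalSpace.Closeds F₁))).subschemeι x : F₁)} ∩ closure (υ ⁻¹' (W \ {(((AlgebraicGeometry.Scheme.IdealSheafData.vanishingIdeal (⟨closure T₁, isClosed_closure⟩ : TopologicalSpace.Closeds F₁))).subschemeι x : F₁)}))), hZ⟩ : TopologicalSpace.Closeds F₂)) → Q F₃ (CategoryTheory.CategoryStruct.comp (CategoryTheory.CategoryStruct.comp υ' υ) ρ)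 (closure (υ' ⁻¹' (closure (υ ⁻¹' (T₁ \ {(((AlgebraicGeometry.Scheme.IdealSheafData.vanishingIdeal (⟨closure T₁, isClosed_closure⟩ : TopologicalSpace.Closeds F₁))).subschemeι x : F₁)})) \ (υ ⁻¹' {(((AlgebraicGeometry.Scheme.IdealSheafData.vanishingIdeal (⟨closure T₁, isClosed_closure⟩ : TopologicalSpace.Closeds F₁))).subschemeι x : F₁)} ∩ closure (υ ⁻¹' (W \ {(((AlgebraicGeometry.Scheme.IdealSheafData.vanishingIdeal (⟨closure T₁, isClosed_closure⟩ : TopologicalSpace.Closeds F₁))).subschemeι x : F₁)}))))))) → Q F' ρ' T') ∧ Literature.AlgebraicGeometry.Resolution.Scheme.IsRegular (AlgebraicGeometry.Scheme.IdealSheafData.vanishingIdeal (⟨closure T', isClosed_closure⟩ : TopologicalSpace.Closeds F')).subscheme) → ∃ (O : Type) (_ : CommRing O) (_ : IsDomain O) (_ : IsDiscreteValuationRing O) (_ : CharZero O) (π : O →+* k), Function.Surjective π ∧ (letI := MvPolynomial.gradedAlgebra (σ := Fin (n + 1)) (R := O); letI := MvPolynomial.gradedAlgebra (σ := Fin (n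 + 1)) (R := k); ∀ (φ : MvPolynomial.homogeneousSubmodule (Fin (n + 1)) O →+*ᵍ MvPolynomial.homogeneousSubmodule (Fin (n + 1)) k) (hφ' : HomogeneousIdeal.irrelevant (MvPolynomial.homogeneousSubmodule (Fin (n + 1)) k) ≤ (HomogeneousIdeal.irrelevant (MvPolynomial.homogeneousSubmodule (Fin (n + 1)) O)).map φ), (∀ s, φ s = MvPolynomial.map π s) → ∀ Y : Set (AlgebraicGeometry.Proj (MvPolynomial.homogeneousSubmodule (Fin (n + 1)) O)), Y = Set.range (CategoryTheory.CategoryStruct.comp ι (AlgebraicGeometry.Proj.map φ hφ') : H ⟶ (AlgebraicGeometry.Proj (MvPolynomial.homogeneousSubmodule (Fin (n + 1)) O))) → ∃ (P' : AlgebraicGeometry.Scheme.{0}) (σ : P' ⟶ (AlgebraicGeometry.Proj (MvPolynomial.homogeneousSubmodule (Fin (n + 1)) O))) (S' : Set P'), (∀ Q : (∀ X' : AlgebraicGeometry.Scheme.{0}, (X' ⟶ (AlgebraicGeometry.Proj (MvPolynomial.homogeneousSubmodule (Fin (n + 1)) O))) → Set X' → Prop), Q (AlgebraicGeometry.Proj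 (MvPolynomial.homogeneousSubmodule (Fin (n + 1)) O)) (CategoryTheory.CategoryStruct.id (AlgebraicGeometry.Proj (MvPolynomial.homogeneousSubmodule (Fin (n + 1)) O))) Y → (∀ (X' X'' : AlgebraicGeometry.Scheme.{0}) (σ' : X' ⟶ (AlgebraicGeometry.Proj (MvPolynomial.homogeneousSubmodule (Fin (n + 1)) O))) (Y' : Set X') (C : X'.IdealSheafData) (τ : X'' ⟶ X'), Q X' σ' Y' → Literature.AlgebraicGeometry.Resolution.IsBlowup τ C → Literature.AlgebraicGeometry.Resolution.Scheme.IsRegular C.subscheme → AlgebraicGeometry.Flat (CategoryTheory.CategoryStruct.comp C.subschemeι (CategoryTheory.CategoryStruct.comp σ' (CategoryTheory.CategoryStruct.comp (AlgebraicGeometry.Proj.toSpecZero (MvPolynomial.homogeneousSubmodule (Fin (n + 1)) O)) (AlgebraicGeometry.Spec.map (CommRingCat.ofHom (algebraMap O (MvPolynomial.homogeneousSubmodule (Fin (n + 1)) O 0))))))) → σ' '' (C.support : Set X') ⊆ {x | ¬ IsGenericPoint x Y} → (C.support : Set X') ∩ (CategoryTheory.CategoryStruct.comp σ' (CategoryTheory.CategoryStruct.comp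 (AlgebraicGeometry.Proj.toSpecZero (MvPolynomial.homogeneousSubmodule (Fin (n + 1)) O)) (AlgebraicGeometry.Spec.map (CommRingCat.ofHom (algebraMap O (MvPolynomial.homogeneousSubmodule (Fin (n + 1)) O 0)))))) ⁻¹' {IsLocalRing.closedPoint O} ⊆ Y' → Q X'' (CategoryTheory.CategoryStruct.comp τ σ') (closure (τ ⁻¹' (Y' \ (C.support : Set X'))))) → Q P' σ S') ∧ Literature.AlgebraicGeometry.Resolution.Scheme.IsRegular (AlgebraicGeometry.Scheme.IdealSheafData.vanishingIdeal (⟨closure S', isClosed_closure⟩ : TopologicalSpace.Closeds P')).subscheme) := by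
  classical
  intro hp k _ _ _ n H ι hι hH hpr HΔTC hres
  refine target_elnat_of_deltaPointResolution' p hp k n H ι hι hH hpr
    (fun F₁ F₂ υ x Z => ∃ (W : Set F₁) (hZ : IsClosed (υ ⁻¹' {x} ∩ closure (υ ⁻¹' (W \ {x})))), x ∈ W ∧
      ¬ (υ ⁻¹' {x} ⊆ closure (υ ⁻¹' (W \ {x}))) ∧
      (∃ U₁ : F₁.affineOpens, x ∈ (U₁ : F₁.Opens) ∧
        ((vanishingIdeal (⟨closure W, isClosed_closure⟩ : Closeds F₁)).ideal U₁).IsPrincipal) ∧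
      Set.Finite {z : ↥(vanishingIdeal (⟨υ ⁻¹' {x} ∩ closure (υ ⁻¹' (W \ {x})), hZ⟩ : Closeds F₂)).subscheme |
        ¬ IsRegularLocalRing ((vanishingIdeal (⟨υ ⁻¹' {x} ∩ closure (υ ⁻¹' (W \ {x})), hZ⟩ :
          Closeds F₂)).subscheme.presheaf.stalk z)} ∧
      Z = vanishingIdeal (⟨υ ⁻¹' {x} ∩ closure (υ ⁻¹' (W \ {x})), hZ⟩ : Closeds F₂))
    ?_ ?_
  · -- HΔ(AdmTC)
    intro O _ _ _ _ _ θ hθ X' r' _ _ hreg hproper U hU s hs hsU X₁ τ₁ hτ₁ F₁ _ j t hsq x hx hss F₂ _ υ hυ j₂ t₂ hsq₂ hcomm hE Z hAdm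
    obtain ⟨W, hZ, hxW, hnot, hU₁, hfin, rfl⟩ := hAdm
    exact HΔTC O θ hθ X' r' hreg hproper U hU s hs hsU X₁ τ₁ hτ₁ F₁ j t hsq x hx hss F₂ υ hυ j₂ t₂ hsq₂ hcomm hE W hZ hxW hnot
      hU₁ hfin
  · -- the stub's downstairs closure is contained in T-ISO-0⁺'s at `Adm := AdmTC`
    obtain ⟨F', ρ', T', hclos, hregD⟩ := hres
    refine ⟨F', ρ', T', fun Q hbase hstep => hclos Q hbase ?_ ?_, hregD⟩
    · intro F₁ F₂ ρ T₁ x υ hx hQ hxreg hFreg hυ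
      exact (hstep F₁ F₂ ρ T₁ x υ hx hQ hxreg hFreg hυ).1
    · intro F₁ F₂ F₃ ρ T₁ x υ hx W υ' hZ hQ hxreg hFreg hυ hxW hnot hU₁ hZT _ hfin hυ'
      have h := (hstep F₁ F₂ ρ T₁ x υ hx hQ hxreg hFreg hυ).2 F₃ (vanishingIdeal ⟨_, hZ⟩) υ'
        ⟨W, hZ, hxW, hnot, hU₁, hfin, rfl⟩ (by rw [coe_support_vanishingIdeal]; exact hZT) hυ'
      rw [coe_support_vanishingIdeal] at h
      exact h

end Summit.ResolutionOfSingularities.ResolutionOfSingularities.Cruxes.EquisingularLiftNat.Sections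

end
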